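import Literature.NumberTheory.Automorphic.ArchInnerTwistPlaceTransport       -- ★ (IT) PART 1 (p852057): `exists_continuousMulEquiv_archLocal_innerTwist`, `innerTwist_mem_chartTorusGLoc_iff`
import Literature.NumberTheory.Automorphic.ArchInnerFormChartOrbLocal           -- ★ G2 `chartOrbGLoc`, `chartOrbGLoc_eq_of_isHaarMeasure`, `isCompact_chartBoxImgGLoc`, `locallyCompactSpace_chartTorusGLoc`
import Literature.NumberTheory.Automorphic.ArchU21SplitPlaceTransport           -- ★ (A2) generic §3 `integral_descConj_map_cosetCongr_subgroup`; brings ★ `InvariantQuotientTransport` (`map_cosetCongr_quotientMeasure`, `subgroupCongrHomeomorph`)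
import Literature.MeasureTheory.Group.InvariantQuotientNormalized               -- ★ `isInvInvariant_map_mulEquiv`
import HarnessLib

/-!
# The place isomorphism carries the local chart functional to the local chart functional: `chartOrbGLoc β (ι⁎ν) (f ∘ ι⁻¹) = chartOrbGLoc α ν f`
# (N8-INNER brick (IT) «IDENTITY TRANSPORT AT I-PLACES», measure half; Deitmar–Echterhoff 2014 Thm. 1.5.3; Rogawski 1990 §14.2 p. 233, §8.2)

Topic `NumberTheory/Automorphic`; namespace `Literature.NumberTheory.Automorphic.UnitaryGroup`.  THEOREMS ONLY (no `def`, no instance, no notation, no axiom, no named fact,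
no `sorry`).  Cell `pub/hodgecm-mathlib`, crux H413 (`stmt-HodgeConjecture-24833`), half-A line LH2, road «N8-INNER» (ROAD FORK 2026-09-02T16:08:52Z, EULER–POINCARÉ road), brick (IT)
PART 2, seat LH7-p04 (g8); sequel of ★ PART 1 `ArchInnerTwistPlaceTransport` (the explicit `ι_w : U(α)_w ≃ₜ* U(β)_w` carrying chart to chart and `T′_{S′,w}` onto `T′_{S′,w}`).
Count-neutral measure bookkeeping; pays no organ by itself.

THE MATHEMATICS.  BINDER FORM: any topological-group isomorphism `ι : U(α)_w ≃ₜ* U(β)_w` with the chart clause `hι : ι (gprimeBlockAt α w S′ c) = gprimeBlockAt β w S′ c` (★ PART 1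
`exists_continuousMulEquiv_archLocal_innerTwist` produces one at every `α`∕`β`-split-chart place).  By ★ PART 1 `innerTwist_mem_chartTorusGLoc_iff` `ι` restricts to `T′_α ≃ₜ* T′_β` on the local chart
tori; for an inversion-invariant Haar measure `t` on `T′_α` its image `t′` is one on `T′_β`, the chart boxes correspond (`t′(B′_β) = t(B′_α)`: the box is the image of ★ `chartBoxLoc` under the chart,
and `ι` fixes the coordinates), the canonical quotient measures correspond (★ `map_cosetCongr_quotientMeasure`: `(cosetCongr ι)⁎(ν∕t) = (ι⁎ν)∕t′`) and the orbital integrand transports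
pointwise (★ `integral_descConj_map_cosetCongr_subgroup`, `ι γ_α(c) = γ_β(c)`).  With the Haar-freeness of the functional (★ `chartOrbGLoc_eq_of_isHaarMeasure`, read with `t` resp. `t′`):
  **`chartOrbGLoc L β w S′ (ν.map ι) (f ∘ ι⁻¹) c = chartOrbGLoc L α w S′ ν f c`**  for EVERY `f`, `c`, `S′`
— Rogawski's «if `v ∉ S₀` we use `ψ_v` to identify `G′_v` with `G_v` … take `f_v` equal to `f′_v`» [Rogawski1990, §14.2 p. 233] on the tree's Cartan atlas, one place at a time.  §1 also records the
whole-group reading `∫_{U(β)_w} Θ(h · ι γ · h⁻¹) d(ι⁎ν) = ∫_{U(α)_w} Θ(ι(g γ g⁻¹)) dν` (Mathlib `integral_map_equiv`) for consumers reading a compact-chart place as a whole-group integral (★ (J-iso) §2).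
* §1 `integral_conj_map_innerTwist` (whole group); §2 `isHaarMeasure_map_innerTwist_restrict`, `map_innerTwist_restrict_chartBoxImgGLoc`, `isHaarMeasure_map_innerTwist`,
  `isMulRightInvariant_map_innerTwist` (the consumer's `haveI`s), **`chartOrbGLoc_map_innerTwist`** (IT3).
HONEST LABEL: HC_CM is proved only modulo the 7 printed citations (2 remaining: hLiu418 = `stmt-HodgeConjecture-24832`, h413 = `stmt-HodgeConjecture-24833`) until rung 0
closes; count-neutral (+0∕+0).

## References
* [DeitmarEchterhoff2014] A. Deitmar, S. Echterhoff, *Principles of Harmonic Analysis*, 2nd ed. (2014), Thm. 1.5.3 (canonical invariant measure on `G ⧸ H`; naturality).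
* [Rogawski1990] J. D. Rogawski, *Automorphic Representations of Unitary Groups in Three Variables*, Ann. of Math. Stud. 123 (1990), §14.2 pp. 232–233, §8.2 p. 122.
* [Folland1995] G. B. Folland, *A Course in Abstract Harmonic Analysis* (1995), §2.6 (2.52) (change of variables along a group isomorphism).
-/

set_option autoImplicit false

noncomputable section

open MeasureTheory MeasureTheory.Measure NumberField NumberField.InfinitePlace Matrix Complex Topology
open Literature.MeasureTheory.Group
open scoped MatrixGroups Matrix ENNReal NNReal

namespace Literature.NumberTheory.Automorphic.UnitaryGroup

section Orb

variable (L : Type) [Field L] [NumberField L] [IsCMField L] (α β : Fin 3 → L) (w : {w : InfinitePlace L // IsComplex w})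
  [MeasurableSpace ↥(archLocal L 3 (Matrix.diagonal α) w)] [BorelSpace ↥(archLocal L 3 (Matrix.diagonal α) w)]
  [MeasurableSpace ↥(archLocal L 3 (Matrix.diagonal β) w)] [BorelSpace ↥(archLocal L 3 (Matrix.diagonal β) w)]
  (ι : ↥(archLocal L 3 (Matrix.diagonal α) w) ≃ₜ* ↥(archLocal L 3 (Matrix.diagonal β) w))
  (ν : Measure ↥(archLocal L 3 (Matrix.diagonal α) w))

/-! ## §1 The whole-group reading -/

omit [NumberField L] [IsCMField L] in
/-- **Whole-group orbital integrals transport along `ι`**: `∫_{U(β)_w} Θ(h · ι γ · h⁻¹) d(ι⁎ν)(h) = ∫_{U(α)_w} Θ(ι (g · γ · g⁻¹)) dν(g)` (Mathlib `integral_map_equiv` along the homeomorphism `ι`),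
for every `Θ` and `γ` — the currency of ★ (J-iso) §2 at a compact-chart place. [cite: Folland1995, §2.6 (2.52)] [cite: Rogawski1990, §14.2 p. 233] -/
theorem integral_conj_map_innerTwist {E : Type*} [NormedAddCommGroup E] [NormedSpace ℝ E] (Θ : ↥(archLocal L 3 (Matrix.diagonal β) w) → E)
    (γ : ↥(archLocal L 3 (Matrix.diagonal α) w)) :
    ∫ h, Θ (h * ι γ * h⁻¹) ∂(ν.map ι) = ∫ g, Θ (ι (g * γ * g⁻¹)) ∂ν := by
  rw [show Measure.map (⇑ι) ν = Measure.map (⇑ι.toHomeomorph.toMeasurableEquiv) ν from rfl, integral_map_equiv]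
  refine integral_congr_ae (Filter.Eventually.of_forall fun g => ?_)
  show Θ (ι g * ι γ * (ι g)⁻¹) = Θ (ι (g * γ * g⁻¹))
  rw [map_mul, map_mul, map_inv]

/-! ## §2 (IT3) The chart functional transports -/

variable (S' : Finset {w : InfinitePlace L // IsComplex w})
  (hι : ∀ (S' : Finset {w : InfinitePlace L // IsComplex w}) (cw : Fin 3 → ℝ), ι (gprimeBlockAt L α w S' cw) = gprimeBlockAt L β w S' cw)

include hι in
/-- The image of a Haar measure on `T′_α` under `ι|_{T′}` is a Haar measure on `T′_β`, inversion-invariant with it. [cite: Folland1995, §2.6 (2.52)] -/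
theorem isHaarMeasure_map_innerTwist_restrict (t : Measure ↥(chartTorusGLoc L α w S')) [t.IsHaarMeasure] [t.IsInvInvariant] :
    (t.map (ContinuousMulEquiv.restrictSubgroup ι (chartTorusGLoc L α w S') (chartTorusGLoc L β w S')
        (fun g => (innerTwist_mem_chartTorusGLoc_iff L α β w ι hι S' g).symm))).IsHaarMeasure ∧
    (t.map (ContinuousMulEquiv.restrictSubgroup ι (chartTorusGLoc L α w S') (chartTorusGLoc L β w S')
        (fun g => (innerTwist_mem_chartTorusGLoc_iff L α β w ι hι S' g).symm))).IsInvInvariant := by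
  haveI := locallyCompactSpace_chartTorusGLoc L α w S'
  haveI := locallyCompactSpace_chartTorusGLoc L β w S'
  set e := ContinuousMulEquiv.restrictSubgroup ι (chartTorusGLoc L α w S') (chartTorusGLoc L β w S') (fun g => (innerTwist_mem_chartTorusGLoc_iff L α β w ι hι S' g).symm)
  exact ⟨e.isHaarMeasure_map t, isInvInvariant_map_mulEquiv e.toMulEquiv e.continuous.measurable t⟩

include hι in
/-- **The boxes correspond**: `(ι|_{T′})⁻¹(B′_β) = B′_α` (the box is the image of ★ `chartBoxLoc` under the chart; `ι` fixes the coordinates), hence equal masses `t′(B′_β) = t(B′_α)`.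
[cite: Rogawski1990, §8.2 p. 122] -/
theorem map_innerTwist_restrict_chartBoxImgGLoc (t : Measure ↥(chartTorusGLoc L α w S')) :
    (t.map (ContinuousMulEquiv.restrictSubgroup ι (chartTorusGLoc L α w S') (chartTorusGLoc L β w S')
        (fun g => (innerTwist_mem_chartTorusGLoc_iff L α β w ι hι S' g).symm))) (chartBoxImgGLoc L β w S') = t (chartBoxImgGLoc L α w S') := by
  set e := ContinuousMulEquiv.restrictSubgroup ι (chartTorusGLoc L α w S') (chartTorusGLoc L β w S') (fun g => (innerTwist_mem_chartTorusGLoc_iff L α β w ι hι S' g).symm) with he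
  rw [Measure.map_apply (show Measurable (fun x => e x) from e.continuous.measurable) (isCompact_chartBoxImgGLoc L β w S').isClosed.measurableSet]
  congr 1
  ext x
  rw [Set.mem_preimage, chartBoxImgGLoc, chartBoxImgGLoc, Set.mem_image, Set.mem_image]
  constructor
  · rintro ⟨cw, hcw, hx⟩
    refine ⟨cw, hcw, Subtype.ext (ι.injective ?_)⟩
    have h := congrArg (fun y : ↥(chartTorusGLoc L β w S') => (y : ↥(archLocal L 3 (Matrix.diagonal β) w))) hx
    simp only [he, ContinuousMulEquiv.coe_restrictSubgroup_apply] at h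
    rw [hι]
    exact h
  · rintro ⟨cw, hcw, rfl⟩
    refine ⟨cw, hcw, Subtype.ext ?_⟩
    rw [he, ContinuousMulEquiv.coe_restrictSubgroup_apply]
    exact (hι S' cw).symm

omit [NumberField L] [IsCMField L] in
/-- `ι⁎ν` is a Haar measure on `U(β)_w` (for the consumer's `haveI`). [cite: Folland1995, §2.6 (2.52)] -/
theorem isHaarMeasure_map_innerTwist [ν.IsHaarMeasure] : (ν.map ι).IsHaarMeasure := ι.isHaarMeasure_map ν

omit [NumberField L] [IsCMField L] in
/-- `ι⁎ν` is right invariant with `ν` (★ `isMulRightInvariant_map_continuousMulEquiv`). [cite: Folland1995, §2.6 (2.52)] -/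
theorem isMulRightInvariant_map_innerTwist [ν.IsMulRightInvariant] : (ν.map ι).IsMulRightInvariant := isMulRightInvariant_map_continuousMulEquiv ι ν

include hι in
/-- **(IT3) THE CHART FUNCTIONAL TRANSPORTS ALONG THE PLACE ISOMORPHISM**: for any Haar measure `ν` on `U(α)_w`, every `f`, `c`, `S′`,
`chartOrbGLoc L β w S′ (ν.map ι) (f ∘ ι⁻¹) c = chartOrbGLoc L α w S′ ν f c` — Haar-freeness (★ `chartOrbGLoc_eq_of_isHaarMeasure`) with `t` and `t′ = (ι|_{T′})⁎t`, equal box masses, naturality of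
the quotient measure (★ `map_cosetCongr_quotientMeasure`) and pointwise transport of the orbital integrand (★ `integral_descConj_map_cosetCongr_subgroup`; `ι γ_α(c) = γ_β(c)`).
[cite: DeitmarEchterhoff2014, Thm. 1.5.3] [cite: Rogawski1990, §14.2 p. 233; §8.2 p. 122] [cite: Folland1995, §2.6 (2.52)] -/
theorem chartOrbGLoc_map_innerTwist [ν.IsHaarMeasure] [ν.IsMulRightInvariant] [(ν.map ι).IsHaarMeasure] [(ν.map ι).IsMulRightInvariant]
    (f : ↥(archLocal L 3 (Matrix.diagonal α) w) → ℂ) (cw : Fin 3 → ℝ) :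
    chartOrbGLoc L β w S' (ν.map ι) (f ∘ ι.symm) cw = chartOrbGLoc L α w S' ν f cw := by
  letI : MeasurableSpace (↥(archLocal L 3 (Matrix.diagonal α) w) ⧸ chartTorusGLoc L α w S') := borel _
  haveI : BorelSpace (↥(archLocal L 3 (Matrix.diagonal α) w) ⧸ chartTorusGLoc L α w S') := ⟨rfl⟩
  letI : MeasurableSpace (↥(archLocal L 3 (Matrix.diagonal β) w) ⧸ chartTorusGLoc L β w S') := borel _
  haveI : BorelSpace (↥(archLocal L 3 (Matrix.diagonal β) w) ⧸ chartTorusGLoc L β w S') := ⟨rfl⟩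
  haveI := locallyCompactSpace_archLocal_three L α w
  haveI := secondCountableTopology_archLocal_three L α w
  haveI := locallyCompactSpace_archLocal_three L β w
  haveI := secondCountableTopology_archLocal_three L β w
  haveI := locallyCompactSpace_chartTorusGLoc L α w S'
  haveI := locallyCompactSpace_chartTorusGLoc L β w S'
  haveI := isHaarMeasure_chartHaarGLoc L α w S'
  haveI := isInvInvariant_chartHaarGLoc L α w S'
  -- the torus measures
  have hιT : ∀ g : ↥(archLocal L 3 (Matrix.diagonal α) w), ι.toMulEquiv g ∈ chartTorusGLoc L β w S' ↔ g ∈ chartTorusGLoc L α w S' :=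
    fun g => innerTwist_mem_chartTorusGLoc_iff L α β w ι hι S' g
  set t : Measure ↥(chartTorusGLoc L α w S') := chartHaarGLoc L α w S' with ht
  set e := ContinuousMulEquiv.restrictSubgroup ι (chartTorusGLoc L α w S') (chartTorusGLoc L β w S') (fun g => (innerTwist_mem_chartTorusGLoc_iff L α β w ι hι S' g).symm) with he
  set t' : Measure ↥(chartTorusGLoc L β w S') := t.map e with ht'
  obtain ⟨hH', hI'⟩ := isHaarMeasure_map_innerTwist_restrict L α β w ι S' hι t
  haveI : t'.IsHaarMeasure := hH'
  haveI : t'.IsInvInvariant := hI'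
  -- `t′` is the image under the subgroup homeomorphism of ★ `cosetCongr`'s API (same underlying map)
  have ht'eq : t' = Measure.map (subgroupCongrHomeomorph ι.toMulEquiv (chartTorusGLoc L α w S') (chartTorusGLoc L β w S') hιT ι.continuous ι.symm.continuous) t := by
    rw [ht']
    congr 1
  -- read both sides Haar-freely, transport the quotient measure and the integrand
  rw [chartOrbGLoc_eq_of_isHaarMeasure L β w S' (ν.map ι) t' (f ∘ ι.symm) cw, chartOrbGLoc_eq_of_isHaarMeasure L α w S' ν t f cw]
  have hbox : t' (chartBoxImgGLoc L β w S') = t (chartBoxImgGLoc L α w S') := map_innerTwist_restrict_chartBoxImgGLoc L α β w ι S' hι t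
  have hq := map_cosetCongr_quotientMeasure ι.toMulEquiv ι.continuous ι.symm.continuous (chartTorusGLoc L α w S') (chartTorusGLoc L β w S') hιT
    (hH := isClosed_chartTorusGLoc L α w S') (hH' := isClosed_chartTorusGLoc L β w S') t t' ν (ν.map ι) ht'eq rfl
  have hγ : ι.toMulEquiv (gprimeBlockAt L α w S' cw) ∈ chartTorusGLoc L β w S' := by
    show ι (gprimeBlockAt L α w S' cw) ∈ chartTorusGLoc L β w S'
    rw [hι]; exact gprimeBlockAt_mem_chartTorusGLoc L β w S' cw
  have hcommβ : ∀ m ∈ chartTorusGLoc L β w S', m * ι.toMulEquiv (gprimeBlockAt L α w S' cw) = ι.toMulEquiv (gprimeBlockAt L α w S' cw) * m := by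
    intro m hm
    have h := forall_mem_chartTorusGLoc_comm L β w S' cw m hm
    have e1 : ι.toMulEquiv (gprimeBlockAt L α w S' cw) = gprimeBlockAt L β w S' cw := hι S' cw
    rw [e1]
    exact h
  have htr := integral_descConj_map_cosetCongr_subgroup ι.toMulEquiv ι.continuous ι.symm.continuous (chartTorusGLoc L α w S') (chartTorusGLoc L β w S') hιT
    (quotientMeasure (chartTorusGLoc L α w S') t (isClosed_chartTorusGLoc L α w S') ν) (forall_mem_chartTorusGLoc_comm L α w S' cw) hcommβ (f ∘ ι.symm)
  have hdesc : descConj (gprimeBlockAt L β w S' cw) (chartTorusGLoc L β w S') (forall_mem_chartTorusGLoc_comm L β w S' cw) (f ∘ ι.symm) =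
      descConj (ι.toMulEquiv (gprimeBlockAt L α w S' cw)) (chartTorusGLoc L β w S') hcommβ (f ∘ ι.symm) := by
    funext y
    induction y using QuotientGroup.induction_on with
    | H g =>
      rw [descConj_mk, descConj_mk]
      show (f ∘ ι.symm) (g * gprimeBlockAt L β w S' cw * g⁻¹) = (f ∘ ι.symm) (g * ι (gprimeBlockAt L α w S' cw) * g⁻¹)
      rw [hι]
  have hfι : ((f ∘ ι.symm) ∘ ι.toMulEquiv : ↥(archLocal L 3 (Matrix.diagonal α) w) → ℂ) = f := by
    funext g
    show f (ι.symm (ι g)) = f g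
    rw [ContinuousMulEquiv.symm_apply_apply]
  rw [hbox]
  congr 1
  rw [← hq, hdesc, htr, hfι]

end Orb

end Literature.NumberTheory.Automorphic.UnitaryGroup

end
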